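import Literature.MathematicalPhysics.QuantumFieldTheory.ConformalBootstrap3D.DimensionalReductionSpin
import Literature.MathematicalPhysics.QuantumFieldTheory.ConformalBootstrap3D.BlockExistence
import Mathlib.Analysis.Normed.Ring.InfiniteSum
import Mathlib.Tactic
import HarnessLib

/-!
# Dimensional reduction `3 → 2`: the function-level statement

`DimensionalReduction3D` and `DimensionalReductionSpin` prove Hogervorst's formula (JHEP 09 (2016) 017 eqs. (2.24)/(2.35),
`d = 3`; Pal–Qiao–Rychkov 2023 Thm A.5; Song 2025) at the level of the `(z, z̄)`-monomial arrays:
`hrMonomialCoeff Δ ℓ = redArr Δ ℓ c` with `c` the closed-form site function. Here we pass to FUNCTIONS on the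
open square `(0,1)²`: with `k_{2h}(x) = x^h Σ_i κ_h(i) x^i` the SL(2) block (`sl2Block`) and `g^{HR}_{Δ,ℓ}` the
block of `BlockExistence` (`hrBlock`, the sum of the Hogervorst–Rychkov `z`-series in Dolan–Osborn normalisation),

  `g^{HR}_{Δ,ℓ}(x, y) = Σ_{a,b ≥ 0} c_{ab} k_{2(α+a)}(x) k_{2(α+b)}(y)`,  `α = (Δ-ℓ)/2`,  `0 < x, y < 1`

as a `HasSum` over `ℕ × ℕ` (`hasSum_redArr_sl2Block`, generic in a non-negative site function `c` with
`hrMonomialCoeff Δ ℓ = redArr Δ ℓ c`; `hrBlock_hasSum_spin` for `ℓ ≥ 1`, `hrBlock_hasSum_scalar` for `ℓ = 0` as a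
single sum over `n`). This is the statement printed as Theorem A.5 in Pal–Qiao–Rychkov 2023 (at `d = 3`), i.e.
`g_{Δ,ℓ} = Σ_{n,j} 𝒜_{n,j} [k_{Δ+2n+j}(z) k_{Δ+2n-j}(z̄)]` with both orders of each unordered pair present in the
sum over `(a,b)`.

Proof: Tonelli for non-negative families. The family `G(P,Q;a,b) = c_{ab} K_a(P) K_b(Q) x^P y^Q` on
`(ℕ×ℕ)×(ℕ×ℕ)` has finite fibre sums `k^{HR}_{PQ} x^P y^Q` (the array identity), hence is summable with sum the
`z`-series (`summable_prod_of_nonneg`); transporting along `(a,b;i,j) ↦ (a+i,b+j;a,b)` and summing the fibres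
`(a,b)` first (`HasSum.prod_fiberwise`, each fibre the product of two convergent SL(2) series) gives the claim.
Convergence of a single SL(2) series `Σ κ_h(i) x^i`, `h > ¼`, `0 ≤ x < 1`, is read off from the scalar case of
the array identity and the convergence of the block's `z`-series (`summable_sl2Coeff_mul_pow`).

References: M. Hogervorst, JHEP 09 (2016) 017, §2 eqs. (2.24), (2.35); S. Pal, J. Qiao, S. Rychkov, Comm. Math. Phys. 402
(2023) 2169, App. A.2 Thm A.5; C. Song, Phys. Rev. Lett. 135 (2025) 211603, §1.
-/

namespace Literature.MathematicalPhysics.QuantumFieldTheory.ConformalBootstrap3D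

open Finset

section Series

/-- The SL(2) ("one-dimensional") conformal block as a real function on `[0,1)`:
`k_{2h}(x) = x^h ₂F₁(h,h;2h;x) = x^h Σ_i κ_h(i) x^i`. [cite: DolanOsborn2011, §2] -/
noncomputable def sl2Block (h x : ℝ) : ℝ :=
  x ^ h * ∑' i : ℕ, sl2Coeff h i * x ^ i

/-- Convergence of the SL(2) series `Σ_i κ_h(i) x^i` for `h > ¼`, `0 ≤ x < 1` — read off from the scalar block:
`κ_h(P) = k^{HR}_{P0}(2h, 0)` and the `z`-series of the block converges on the bidisk. [folklore] -/
theorem summable_sl2Coeff_mul_pow {h : ℝ} (hh : 1 / 4 < h) {x : ℝ} (hx0 : 0 ≤ x) (hx1 : x < 1) :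
    Summable (fun i : ℕ => sl2Coeff h i * x ^ i) := by
  have hb : unitarityBound3D 0 < 2 * h := by
    unfold unitarityBound3D; norm_num; linarith
  have h2 : (1 : ℝ) / 2 < 2 * h := by linarith
  have hs := summable_hrMonomialCoeff_mul_pow hb hx0 hx1
  have hinj : Function.Injective (fun P : ℕ => ((P, 0) : ℕ × ℕ)) := fun P P' hP => (Prod.mk.inj hP).1
  refine (hs.comp_injective hinj).congr (fun P => ?_)
  simp only [Function.comp_apply, add_zero]
  rw [hrMonomialCoeff_scalar_apply h2, Finset.sum_eq_single 0]
  · have : 2 * h / 2 + ((0 : ℕ) : ℝ) = h := by push_cast; ring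
    rw [this]
    simp
  · intro n _ hn0
    have hneg : ((0 : ℕ) : ℤ) - (n : ℤ) < 0 := by omega
    rw [sl2CoeffZ_of_neg _ hneg]
    ring
  · intro h0
    exact absurd (Finset.mem_range.mpr (Nat.succ_pos P)) h0

/-- The defining series of `k_{2h}(x)` (with the prefactor `x^h` distributed): `HasSum_i x^h κ_h(i) x^i = k_{2h}(x)`.
[folklore] -/
theorem hasSum_sl2Block {h : ℝ} (hh : 1 / 4 < h) {x : ℝ} (hx0 : 0 ≤ x) (hx1 : x < 1) :
    HasSum (fun i : ℕ => x ^ h * (sl2Coeff h i * x ^ i)) (sl2Block h x) :=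
  ((summable_sl2Coeff_mul_pow hh hx0 hx1).hasSum).mul_left _

variable {Δ : ℝ} {ℓ : ℕ}

/-- The fibre sums of the four-index family: for fixed `(P,Q)`,
`Σ_{a,b} c_{ab} K_a(P) K_b(Q) x^P y^Q = redArr c (P,Q) · x^P y^Q` (a finite sum: `K_a(P) = 0` for `a > P`).
[folklore] -/
theorem hasSum_redArr_fibre (c : ℕ → ℕ → ℝ) (P Q : ℕ) (x y : ℝ) :
    HasSum (fun q : ℕ × ℕ => c q.1 q.2 * siteK Δ ℓ q.1 P * siteK Δ ℓ q.2 Q * (x ^ P * y ^ Q))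
      (redArr Δ ℓ c (P, Q) * (x ^ P * y ^ Q)) := by
  have hzero : ∀ q ∉ range (P + 1) ×ˢ range (Q + 1),
      c q.1 q.2 * siteK Δ ℓ q.1 P * siteK Δ ℓ q.2 Q * (x ^ P * y ^ Q) = 0 := by
    intro q hq
    rw [Finset.mem_product, Finset.mem_range, Finset.mem_range, not_and_or] at hq
    rcases hq with h1 | h1
    · have h1' : P < q.1 := by omega
      rw [siteK_eq_zero_of_lt (Δ := Δ) (ℓ := ℓ) q.1 (by exact_mod_cast h1')]
      ring
    · have h1' : Q < q.2 := by omega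
      rw [siteK_eq_zero_of_lt (Δ := Δ) (ℓ := ℓ) q.2 (by exact_mod_cast h1')]
      ring
  have h : HasSum (fun q : ℕ × ℕ => c q.1 q.2 * siteK Δ ℓ q.1 P * siteK Δ ℓ q.2 Q * (x ^ P * y ^ Q))
      (∑ q ∈ range (P + 1) ×ˢ range (Q + 1),
        c q.1 q.2 * siteK Δ ℓ q.1 P * siteK Δ ℓ q.2 Q * (x ^ P * y ^ Q)) :=
    hasSum_sum_of_ne_finset_zero hzero
  have hval : (∑ q ∈ range (P + 1) ×ˢ range (Q + 1),
      c q.1 q.2 * siteK Δ ℓ q.1 P * siteK Δ ℓ q.2 Q * (x ^ P * y ^ Q)) =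
      redArr Δ ℓ c (P, Q) * (x ^ P * y ^ Q) := by
    rw [Finset.sum_product, redArr, Finset.sum_mul]
    refine Finset.sum_congr rfl (fun a _ => ?_)
    rw [Finset.sum_mul]
  rw [hval] at h
  exact h

/-- `K_a(a+i) = κ_{α+a}(i)`. [folklore] -/
theorem siteK_add (a i : ℕ) : siteK Δ ℓ a ((a + i : ℕ) : ℤ) = sl2Coeff (halfTwist Δ ℓ + a) i := by
  unfold siteK
  have : ((a + i : ℕ) : ℤ) - (a : ℤ) = (i : ℤ) := by push_cast; ring
  rw [this, sl2CoeffZ_natCast]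

/-- One SL(2) factor with its shift: `HasSum_i κ_{α+a}(i) x^{a+i} = x^a Σ_i κ_{α+a}(i) x^i`. [folklore] -/
theorem hasSum_sl2Coeff_shift (hα : 1 / 4 < halfTwist Δ ℓ) (a : ℕ) {x : ℝ} (hx0 : 0 ≤ x) (hx1 : x < 1) :
    HasSum (fun i : ℕ => sl2Coeff (halfTwist Δ ℓ + a) i * x ^ (a + i))
      (x ^ a * ∑' i : ℕ, sl2Coeff (halfTwist Δ ℓ + a) i * x ^ i) := by
  have ha : 1 / 4 < halfTwist Δ ℓ + a := by have := (Nat.cast_nonneg a : (0 : ℝ) ≤ a); linarith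
  have h := ((summable_sl2Coeff_mul_pow ha hx0 hx1).hasSum).mul_left (x ^ a)
  exact h.congr_fun (fun i => by rw [pow_add]; ring)

/-- **Dimensional reduction, function level (generic site function).** If `c ≥ 0` and the monomial array of
the block is `redArr Δ ℓ c` (as proved for the closed forms in `DimensionalReduction3D`/`DimensionalReductionSpin`),
then on the open square `g^{HR}_{Δ,ℓ}(x,y) = Σ_{a,b} c_{ab} k_{2(α+a)}(x) k_{2(α+b)}(y)` as a convergent double
series. [cite: PalQiaoRychkov2023, App. A.2 Thm A.5] -/
theorem hasSum_redArr_sl2Block (hΔ : unitarityBound3D ℓ < Δ) (hα : 1 / 4 < halfTwist Δ ℓ)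
    (c : ℕ → ℕ → ℝ) (hc : ∀ a b, 0 ≤ c a b) (hred : hrMonomialCoeff Δ ℓ = redArr Δ ℓ c)
    {x y : ℝ} (hx0 : 0 < x) (hx1 : x < 1) (hy0 : 0 < y) (hy1 : y < 1) :
    HasSum (fun p : ℕ × ℕ => c p.1 p.2 * sl2Block (halfTwist Δ ℓ + p.1) x * sl2Block (halfTwist Δ ℓ + p.2) y)
      (hrBlock Δ ℓ x y) := by
  have hα0 : 0 < halfTwist Δ ℓ := by linarith
  -- the four-index family, grouped by `(P,Q)`
  set G : (ℕ × ℕ) × (ℕ × ℕ) → ℝ :=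
    fun r => c r.2.1 r.2.2 * siteK Δ ℓ r.2.1 r.1.1 * siteK Δ ℓ r.2.2 r.1.2 * (x ^ r.1.1 * y ^ r.1.2) with hG
  have hGnn : 0 ≤ G := fun r => by
    have h1 := siteK_nonneg hα0 r.2.1 (r.1.1 : ℤ)
    have h2 := siteK_nonneg hα0 r.2.2 (r.1.2 : ℤ)
    have h3 := hc r.2.1 r.2.2
    simp only [hG]
    positivity
  have hfib : ∀ p : ℕ × ℕ, HasSum (fun q : ℕ × ℕ => G (p, q))
      (hrMonomialCoeff Δ ℓ p * (x ^ p.1 * y ^ p.2)) := fun p => by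
    rw [hred]
    exact hasSum_redArr_fibre c p.1 p.2 x y
  -- the `z`-series at `(x,y)`
  have hser : HasSum (fun p : ℕ × ℕ => hrMonomialCoeff Δ ℓ p * (x ^ p.1 * y ^ p.2)) (hrSeries Δ ℓ x y) := by
    obtain ⟨hs, -⟩ := isDoublePowerSeriesOn_hrSeries hΔ x y
      (by rw [abs_of_pos hx0]; exact hx1) (by rw [abs_of_pos hy0]; exact hy1)
    have hs' : Summable (fun p : ℕ × ℕ => hrMonomialCoeff Δ ℓ p * x ^ p.1 * y ^ p.2) := by
      refine hs.congr (fun p => ?_)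
      rw [abs_of_nonneg (hrMonomialCoeff_nonneg hΔ p), abs_of_pos hx0, abs_of_pos hy0]
    have h := hs'.hasSum
    unfold hrSeries
    convert h using 1
    funext p
    ring
  have hGsum : Summable G := by
    rw [summable_prod_of_nonneg hGnn]
    exact ⟨fun p => (hfib p).summable, hser.summable.congr (fun p => ((hfib p).tsum_eq).symm)⟩
  have hGhas : HasSum G (hrSeries Δ ℓ x y) := by
    have h1 : HasSum (fun p : ℕ × ℕ => hrMonomialCoeff Δ ℓ p * (x ^ p.1 * y ^ p.2)) (∑' r, G r) :=
      hGsum.hasSum.prod_fiberwise hfib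
    rw [← h1.unique hser]
    exact hGsum.hasSum
  -- transport along `(a,b;i,j) ↦ (a+i,b+j;a,b)`
  set Φ : (ℕ × ℕ) × (ℕ × ℕ) → (ℕ × ℕ) × (ℕ × ℕ) :=
    fun r => ((r.1.1 + r.2.1, r.1.2 + r.2.2), r.1) with hΦ
  have hΦinj : Function.Injective Φ := by
    rintro ⟨⟨a, b⟩, ⟨i, j⟩⟩ ⟨⟨a', b'⟩, ⟨i', j'⟩⟩ h
    simp only [hΦ, Prod.mk.injEq] at h
    obtain ⟨⟨h1, h2⟩, h3, h4⟩ := h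
    subst h3; subst h4
    have hi : i = i' := by omega
    have hj : j = j' := by omega
    rw [hi, hj]
  have hΦsupp : ∀ r, r ∉ Set.range Φ → G r = 0 := by
    rintro ⟨⟨P, Q⟩, ⟨a, b⟩⟩ hr
    by_cases ha : a ≤ P
    · by_cases hb : b ≤ Q
      · exact (hr ⟨((a, b), (P - a, Q - b)), by
          simp only [hΦ]
          rw [Nat.add_sub_cancel' ha, Nat.add_sub_cancel' hb]⟩).elim
      · have hb' : Q < b := Nat.lt_of_not_le hb
        simp only [hG]
        rw [siteK_eq_zero_of_lt (Δ := Δ) (ℓ := ℓ) b (by exact_mod_cast hb')]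
        ring
    · have ha' : P < a := Nat.lt_of_not_le ha
      simp only [hG]
      rw [siteK_eq_zero_of_lt (Δ := Δ) (ℓ := ℓ) a (by exact_mod_cast ha')]
      ring
  have hF : HasSum (G ∘ Φ) (hrSeries Δ ℓ x y) := (hΦinj.hasSum_iff hΦsupp).mpr hGhas
  -- the fibres `(a,b)` of `G ∘ Φ` are products of two SL(2) series
  have hfib2 : ∀ p : ℕ × ℕ, HasSum (fun q : ℕ × ℕ => (G ∘ Φ) (p, q))
      (c p.1 p.2 * ((x ^ p.1 * ∑' i : ℕ, sl2Coeff (halfTwist Δ ℓ + p.1) i * x ^ i) *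
        (y ^ p.2 * ∑' j : ℕ, sl2Coeff (halfTwist Δ ℓ + p.2) j * y ^ j))) := fun p => by
    have hf := hasSum_sl2Coeff_shift hα p.1 hx0.le hx1
    have hg := hasSum_sl2Coeff_shift hα p.2 hy0.le hy1
    have ha : 0 < halfTwist Δ ℓ + p.1 := by positivity
    have hb : 0 < halfTwist Δ ℓ + p.2 := by positivity
    have hfg := hf.summable.mul_of_nonneg hg.summable
      (fun i => mul_nonneg (sl2Coeff_nonneg ha i) (pow_nonneg hx0.le _))
      (fun j => mul_nonneg (sl2Coeff_nonneg hb j) (pow_nonneg hy0.le _))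
    have h := (hf.mul hg hfg).mul_left (c p.1 p.2)
    refine h.congr_fun (fun q => ?_)
    simp only [Function.comp_apply, hΦ, hG, siteK_add]
    ring
  have hpairs := hF.prod_fiberwise hfib2
  -- multiply by `(xy)^α` and fold the SL(2) blocks
  have hblock := hpairs.mul_left ((x * y) ^ halfTwist Δ ℓ)
  show HasSum _ ((x * y) ^ halfTwist Δ ℓ * hrSeries Δ ℓ x y)
  refine hblock.congr_fun (fun p => ?_)
  unfold sl2Block
  rw [Real.mul_rpow hx0.le hy0.le, Real.rpow_add hx0, Real.rpow_add hy0, Real.rpow_natCast,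
    Real.rpow_natCast]
  ring

/-- **Hogervorst's dimensional reduction at `d = 3`, function level, spin `ℓ ≥ 1`**: for `Δ > ℓ + 1` off the
accidental set and `0 < x, y < 1`,
`g^{HR}_{Δ,ℓ}(x,y) = Σ_{a,b} c_{ab} k_{2(α+a)}(x) k_{2(α+b)}(y)` with `c = spinSite Δ ℓ` Hogervorst's closed form
(eq. (2.35)) in lattice variables. [cite: Hogervorst2016, §2 eqs. (2.24), (2.35)] [cite: PalQiaoRychkov2023, App. A.2 Thm A.5]
[cite: Song2025, §1] -/
theorem hrBlock_hasSum_spin (hℓ : 1 ≤ ℓ) (hΔ : (ℓ : ℝ) + 1 < Δ) (hreg : ¬ accidentalDegeneracy3D Δ ℓ)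
    {x y : ℝ} (hx0 : 0 < x) (hx1 : x < 1) (hy0 : 0 < y) (hy1 : y < 1) :
    HasSum (fun p : ℕ × ℕ =>
      spinSite Δ ℓ p.1 p.2 * sl2Block (halfTwist Δ ℓ + p.1) x * sl2Block (halfTwist Δ ℓ + p.2) y)
      (hrBlock Δ ℓ x y) := by
  have hb : unitarityBound3D ℓ < Δ := by
    unfold unitarityBound3D; rw [if_neg (by omega)]; exact hΔ
  have hα : 1 / 4 < halfTwist Δ ℓ := by unfold halfTwist; linarith
  exact hasSum_redArr_sl2Block hb hα (spinSite Δ ℓ) (spinSite_nonneg hΔ)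
    (hrMonomialCoeff_eq_spin_redArr hℓ hΔ hreg) hx0 hx1 hy0 hy1

/-- **Hogervorst's dimensional reduction at `d = 3`, function level, scalar blocks**: for `Δ > ½` and
`0 < x, y < 1`, `g^{HR}_{Δ,0}(x,y) = Σ_{n ≥ 0} 𝒜_{n,0}(Δ,0) k_{Δ+2n}(x) k_{Δ+2n}(y)` (a single sum).
[cite: Hogervorst2016, §2 eqs. (2.24), (2.35)] [cite: PalQiaoRychkov2023, App. A.2 Thm A.5] [cite: Song2025, §3] -/
theorem hrBlock_hasSum_scalar (hΔ : 1 / 2 < Δ) {x y : ℝ} (hx0 : 0 < x) (hx1 : x < 1) (hy0 : 0 < y)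
    (hy1 : y < 1) :
    HasSum (fun n : ℕ => scalarRedCoeff Δ n * sl2Block (Δ / 2 + n) x * sl2Block (Δ / 2 + n) y)
      (hrBlock Δ 0 x y) := by
  have hb : unitarityBound3D 0 < Δ := by unfold unitarityBound3D; norm_num; linarith
  have hα : 1 / 4 < halfTwist Δ 0 := by unfold halfTwist; push_cast; linarith
  have h2 := hasSum_redArr_sl2Block hb hα (scalarSite Δ)
    (fun a b => by
      unfold scalarSite; split_ifs
      · exact (scalarRedCoeff_pos hΔ _).le
      · exact le_rfl)
    (hrMonomialCoeff_eq_scalar_redArr hΔ) hx0 hx1 hy0 hy1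
  -- the site function is diagonal: pass from `ℕ × ℕ` to the diagonal `n ↦ (n,n)`
  have hinj : Function.Injective (fun n : ℕ => ((n, n) : ℕ × ℕ)) := fun n n' h => (Prod.mk.inj h).1
  have hsupp : ∀ p : ℕ × ℕ, p ∉ Set.range (fun n : ℕ => ((n, n) : ℕ × ℕ)) →
      scalarSite Δ p.1 p.2 * sl2Block (halfTwist Δ 0 + p.1) x * sl2Block (halfTwist Δ 0 + p.2) y = 0 := by
    rintro ⟨a, b⟩ hp
    have hab : a ≠ b := fun h => hp ⟨a, by simp [h]⟩
    simp [scalarSite, hab]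
  have h3 := (hinj.hasSum_iff hsupp).mpr h2
  refine h3.congr_fun (fun n => ?_)
  simp [Function.comp_apply, scalarSite, halfTwist_zero_spin]

/-- `tsum` form of `hrBlock_hasSum_spin`: `g^{HR}_{Δ,ℓ}(x,y) = Σ'_{(a,b)} c_{ab} k_{2(α+a)}(x) k_{2(α+b)}(y)`.
[cite: Hogervorst2016, §2 eqs. (2.24), (2.35)] -/
theorem hrBlock_eq_tsum_spin (hℓ : 1 ≤ ℓ) (hΔ : (ℓ : ℝ) + 1 < Δ) (hreg : ¬ accidentalDegeneracy3D Δ ℓ)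
    {x y : ℝ} (hx0 : 0 < x) (hx1 : x < 1) (hy0 : 0 < y) (hy1 : y < 1) :
    hrBlock Δ ℓ x y = ∑' p : ℕ × ℕ,
      spinSite Δ ℓ p.1 p.2 * sl2Block (halfTwist Δ ℓ + p.1) x * sl2Block (halfTwist Δ ℓ + p.2) y :=
  (hrBlock_hasSum_spin hℓ hΔ hreg hx0 hx1 hy0 hy1).tsum_eq.symm

/-- `tsum` form of `hrBlock_hasSum_scalar`: `g^{HR}_{Δ,0}(x,y) = Σ'_n 𝒜_{n,0}(Δ,0) k_{Δ+2n}(x) k_{Δ+2n}(y)`.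
[cite: Hogervorst2016, §2 eqs. (2.24), (2.35)] -/
theorem hrBlock_eq_tsum_scalar (hΔ : 1 / 2 < Δ) {x y : ℝ} (hx0 : 0 < x) (hx1 : x < 1) (hy0 : 0 < y)
    (hy1 : y < 1) :
    hrBlock Δ 0 x y = ∑' n : ℕ, scalarRedCoeff Δ n * sl2Block (Δ / 2 + n) x * sl2Block (Δ / 2 + n) y :=
  (hrBlock_hasSum_scalar hΔ hx0 hx1 hy0 hy1).tsum_eq.symm

end Series

end Literature.MathematicalPhysics.QuantumFieldTheory.ConformalBootstrap3D
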